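import Summits.Ventures.Crystal3D.Theorems.StickyWulffConstantCoaxialWallLawTailResidueDefs2
import HarnessLib

/-!
# Definitions III: LENS TYPES — loose fillers in any number, joint witnesses, NO filler credit
# (crux `CoaxialWallLaw`, stmt-Ventures-19481, line `WallLedgerF`; cf-p1 DECISION (cxi) «T4 soundness repair», 2026-08-29T05:03:45Z)

HONEST FRAMING. Venture `Summits/Ventures/Crystal3D` (cell `crystal3d-full`); DEFINITIONS ONLY for the crux `CoaxialWallLaw`
(stmt-Ventures-19481, `route-Ventures-StickyWulffConstant`), registered line 'CoaxialWallLawCertificates' (planner cf-p1).  Nothing is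
claimed; F-C1 not moved.  REPAIRS `…TailResidueDefs2` (p691604), whose typed functional is more optimistic than the true off-module summand in
two places (memo F-TAIL-g9 §9, accepted in (cxi)): the filler CREDIT `10 − #H` (false with undeletable danglers) and the filler COUNT `≤ 3`
(no global reason).  Per (cxi)(b), the repair of record:
* `HostRef` — a host of a loose filler is ANY exact ball: a module site, a rigid apex filler, or a ball of the reflected (junction) grain
  (Defs2 allowed only sites, under-counting decorated degrees of apex/junction payers);
* `ResidueType₃` — `occ`, `rigid` (apex fillers `(y, a, b, up)`, any number), `loose` (host sets, ANY number, duplicates allowed), `junction`;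
* `WellFormed₃` (decidable data conditions; NO length bounds, NO `#H ≤ 3`), `realise₃`, `hostPoint`, `looseAt₃`;
* `Realisable₃` — exact balls `1`-separated, rigid apexes off-module, and a JOINT system of loose witnesses: each off-module, at no
  first-generation apex position of an occupied site, at distance `1` from its hosts, `> 1` from every other exact ball, and PAIRWISE `≥ 1`
  apart ((α) of (cxi)); the adjacent-divacancy LENS condition (β) is then a theorem (`foreign_contact_adjacent_divacancy`, p682840-style) and
  is not restated; finiteness of the realisable types is the lens-capacity lemma (separate file), not an axiom;
* `rowJoint₃` — the kernel-literal joint row with decorated degrees `looseAt₃` and credit `κ := 0` ((γ): fillers never pay; sound by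
  `dustCredit_nonneg`), `TailResidueCert₃ s`, `TailTypeSoundness₃` (same shape as II).
WHAT THIS IS NOT: any statement about packings; F-C1 not moved.  `…TailResidueClosing3` re-instantiates the closing theorem on these names.
-/

noncomputable section

namespace Summit.Ventures.Crystal3D.Theorems

namespace TailResidue

open Summit.Ventures.Crystal3D Finset
open scoped InnerProductSpace

/-! ### Host references and types -/

/-- A reference to an exact ball usable as a host of a loose filler: a module site, a rigid apex filler `(y, a, b, up)`, or a site of the
reflected (junction) grain. -/
inductive HostRef
  | site (s : ℤ × ℤ × ℤ)
  | apex (y a b : ℤ × ℤ × ℤ) (up : Bool)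
  | junc (s : ℤ × ℤ × ℤ)
  deriving DecidableEq

/-- **LENS TYPE**: occupied module sites, rigid apex fillers (any number), loose fillers as host sets (any number), optional junction. -/
structure ResidueType₃ where
  /-- occupied sites of the module core -/
  occ : Finset (ℤ × ℤ × ℤ)
  /-- rigid apex fillers `(y, a, b, up)`: the apex over the adjacent menu pair `(a, b)` at the occupied host `y`, side `up` -/
  rigid : List ((ℤ × ℤ × ℤ) × (ℤ × ℤ × ℤ) × (ℤ × ℤ × ℤ) × Bool)
  /-- loose fillers: their host sets -/
  loose : List (Finset HostRef)
  /-- junction datum: mirror index, plane site, occupied sites of the second grain (preimage sites) -/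
  junction : Option (Fin 6 × (ℤ × ℤ × ℤ) × Finset (ℤ × ℤ × ℤ))
  deriving DecidableEq

/-- A host reference is VALID for the type: an occupied site, a listed rigid filler, or a listed junction site. -/
def ResidueType₃.ValidHost (τ : ResidueType₃) : HostRef → Prop
  | .site s => s ∈ τ.occ
  | .apex y a b up => (y, a, b, up) ∈ τ.rigid
  | .junc s => match τ.junction with
    | none => False
    | some J => s ∈ J.2.2

/-- A host reference is NEAR the payer (its base site within `3`: `dsq12 ≤ 108`) — the relevance filter. -/
def HostRef.Near : HostRef → Prop
  | .site s => dsq12 (0, 0, 0) s ≤ 48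
  | .apex y _ _ _ => dsq12 (0, 0, 0) y ≤ 108
  | .junc _ => True

/-- **Well-formedness III** (decidable data conditions; no count bounds). -/
def ResidueType₃.WellFormed₃ (τ : ResidueType₃) : Prop :=
  τ.occ ⊆ siteBall ∧ ((0, 0, 0) : ℤ × ℤ × ℤ) ∈ τ.occ ∧ (∀ s ∈ τ.occ, ∀ t ∈ τ.occ, s ≠ t → 12 ≤ dsq12 s t) ∧
    (τ.occ.filter fun s => dsq12 (0, 0, 0) s = 12).card ≤ 11 ∧
    (∀ r ∈ τ.rigid, r.1 ∈ τ.occ ∧ dsq12 (0, 0, 0) r.1 ≤ 48 ∧ r.2.1 ∈ menuOffsets ∧ r.2.2.1 ∈ menuOffsets ∧ dsq12 r.2.1 r.2.2.1 = 12) ∧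
    (∀ H ∈ τ.loose, 1 ≤ H.card ∧ (∀ h ∈ H, τ.ValidHost h) ∧ ∃ h ∈ H, h.Near) ∧
    (match τ.junction with
      | none => True
      | some J => J.2.2 ⊆ siteBall ∧ J.2.1 ∈ siteBall)

/-! ### Realisation -/

/-- The point of a rigid apex filler. -/
def apexPoint (r : (ℤ × ℤ × ℤ) × (ℤ × ℤ × ℤ) × (ℤ × ℤ × ℤ) × Bool) : EuclideanSpace ℝ (Fin 3) :=
  modSite r.1 + apexVec (modSite r.2.1) (modSite r.2.2.1) r.2.2.2

/-- The point of a host reference (junction sites are reflected across the junction mirror; junk if there is no junction). -/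
def ResidueType₃.hostPoint (τ : ResidueType₃) : HostRef → EuclideanSpace ℝ (Fin 3)
  | .site s => modSite s
  | .apex y a b up => apexPoint (y, a, b, up)
  | .junc s => match τ.junction with
    | none => modSite s
    | some J => reflectAt (inclinedNormal J.1) (modSite J.2.1) (modSite s)

/-- The exact balls of a lens type: occupied sites, rigid apexes, and (if any) the reflected second grain. -/
def ResidueType₃.realise₃ (τ : ResidueType₃) : Finset (EuclideanSpace ℝ (Fin 3)) :=
  τ.occ.image modSite ∪ (τ.rigid.map apexPoint).toFinset ∪
    (match τ.junction with
      | none => ∅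
      | some J => J.2.2.image fun s => reflectAt (inclinedNormal J.1) (modSite J.2.1) (modSite s))

open scoped Classical in
/-- The number of loose fillers hosted by the exact ball at `y`. -/
def ResidueType₃.looseAt₃ (τ : ResidueType₃) (y : EuclideanSpace ℝ (Fin 3)) : ℕ :=
  (τ.loose.filter fun H => y ∈ H.image τ.hostPoint).length

/-- **Realisability III**: exact balls `1`-separated; rigid apexes off the module; and a JOINT system of loose witnesses — each off the
module, at no first-generation apex position of an occupied site, at distance `1` from its hosts, `> 1` from every other exact ball — that
are PAIRWISE `≥ 1` apart. -/
def ResidueType₃.Realisable₃ (τ : ResidueType₃) : Prop :=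
  (∀ p ∈ τ.realise₃, ∀ q ∈ τ.realise₃, p ≠ q → (1 : ℝ) ≤ dist p q) ∧
  (∀ r ∈ τ.rigid, apexPoint r ∉ coaxialModule 1 (Real.sqrt (2 / 3))) ∧
  ∃ ξ : ℕ → EuclideanSpace ℝ (Fin 3),
    (∀ i : ℕ, ∀ H : Finset HostRef, τ.loose[i]? = some H →
      ξ i ∉ coaxialModule 1 (Real.sqrt (2 / 3)) ∧ (∀ q ∈ τ.occ, ∀ v ∈ apexVecs, ξ i ≠ modSite q + v) ∧
      (∀ h ∈ H, dist (ξ i) (τ.hostPoint h) = 1) ∧ (∀ p ∈ τ.realise₃, p ∉ H.image τ.hostPoint → 1 < dist (ξ i) p)) ∧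
    (∀ i j : ℕ, i ≠ j → i < τ.loose.length → j < τ.loose.length → (1 : ℝ) ≤ dist (ξ i) (ξ j))

/-! ### Rows without filler credit, the finite fact and the soundness target -/

/-- **The JOINT row of a lens type** at the placement `L₀`: kernel-literal, decorated degrees `looseAt₃`, credit `0`. -/
def ResidueType₃.rowJoint₃ (τ : ResidueType₃) (L₀ : EuclideanSpace ℝ (Fin 3) ≃ₗᵢ[ℝ] EuclideanSpace ℝ (Fin 3)) : ℝ :=
  localSummandFlatDec WordVersion.v2 (basalSystem L₀)
    (basalSystem (((ℝ ∙ EuclideanSpace.single (2 : Fin 3) (1 : ℝ)).reflection).trans L₀)) τ.realise₃ τ.looseAt₃ (fun _ => 0) 0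

/-- **THE TAIL RESIDUE CERTIFICATE III at the line `s`**: every well-formed realisable LENS type has joint row `≤ s` at every standard
placement.  Instance of record `s = 2√6`. -/
def TailResidueCert₃ (s : ℝ) : Prop :=
  ∀ τ : ResidueType₃, τ.WellFormed₃ → τ.Realisable₃ →
    ∀ L₀ : EuclideanSpace ℝ (Fin 3) ≃ₗᵢ[ℝ] EuclideanSpace ℝ (Fin 3), StdFrame L₀ → τ.rowJoint₃ L₀ ≤ s

open scoped Classical in
/-- **TYPE SOUNDNESS III (THE T4 TARGET after (cxi))**: at every payer window of a `1`-separated configuration that is NOT on-site for 𝒰_cx,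
either a deletion of inessential balls lands on-site, or the JOINT summand of the frame `L` is bounded by the joint row of some well-formed
realisable lens type at some standard placement. -/
def TailTypeSoundness₃ : Prop :=
  ∀ L : EuclideanSpace ℝ (Fin 3) ≃ₗᵢ[ℝ] EuclideanSpace ℝ (Fin 3),
  ∀ X : Finset (EuclideanSpace ℝ (Fin 3)), (∀ p ∈ X, ∀ q ∈ X, p ≠ q → 1 ≤ dist p q) →
  ∀ z ∈ X, (X.filter fun q => dist z q = 1).card ≤ 11 → ¬ OnSiteAt coaxialModuleUniverse X z →
    HasDeletionOnSite X z ∨ ∃ τ : ResidueType₃, τ.WellFormed₃ ∧ τ.Realisable₃ ∧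
      ∃ L₀ : EuclideanSpace ℝ (Fin 3) ≃ₗᵢ[ℝ] EuclideanSpace ℝ (Fin 3), StdFrame L₀ ∧
        localSummandA WordVersion.v2 (basalSystem L)
          (basalSystem (((ℝ ∙ EuclideanSpace.single (2 : Fin 3) (1 : ℝ)).reflection).trans L)) X z ≤ τ.rowJoint₃ L₀

/-! ### AMENDMENT (same session): credit-free pools that cannot vanish — the LENS functional of record

The first text above defines `rowJoint₃` through `localSummandFlatDec … (fun _ => 0)`, i.e. with Defs-I's `HasTwoPayersDec`, which counts
loose fillers as payers of the two-payer clause.  With credit `0` that pool can be `0` (a saturated `b` hosting `≥ 2` loose fillers and no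
deficient exact payer within `1`), so the typed term `e/0 = 0` would UNDER-estimate a true positive term — an unsound corner.  The functional of
record is therefore the following credit-free one, whose two-payer clause counts EXACT deficient contacts only (every pool is `≥ 1`, and `≤`
the true pooled deficiency whenever the true two-payer clause holds: a missing exact payer is a dust payer of deficiency `≥ 1`).
`rowJoint₃ / TailResidueCert₃ / TailTypeSoundness₃` are DEPRECATED in favour of `rowJointL / TailResidueCertL / TailTypeSoundnessL`. -/

variable (P : Finset (EuclideanSpace ℝ (Fin 3))) (δ : EuclideanSpace ℝ (Fin 3) → ℕ) in
open scoped Classical in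
/-- Decorated two-payer clause, LENS form: `b` deficient at its decorated degree, or at least two deficient EXACT contacts of `b`. -/
def HasTwoPayersDecL (b : EuclideanSpace ℝ (Fin 3)) : Prop :=
  degDec P δ b ≤ 11 ∨ 2 ≤ (P.filter fun y => dist b y = 1 ∧ degDec P δ y ≤ 11).card

variable (P : Finset (EuclideanSpace ℝ (Fin 3))) (δ : EuclideanSpace ℝ (Fin 3) → ℕ) in
open scoped Classical in
/-- Decorated flat pool, LENS form: deficiencies of the exact payers within `1` of `b` at decorated degrees plus the activation unit; NO filler
credit (fillers never pay).  Always `≥ 1`. -/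
def pooledDefFlatDecL (b : EuclideanSpace ℝ (Fin 3)) : ℝ :=
  (∑ y ∈ P.filter (fun y => dist b y ≤ 1 ∧ degDec P δ y ≤ 11), ((12 : ℝ) - (degDec P δ y : ℝ))) +
    if HasTwoPayersDecL P δ b then 0 else 1

open scoped Classical in
/-- **THE DECORATED FLAT SUMMAND, LENS form (kernel-literal)**: flat multiplicities of the exact configuration over the pools
`pooledDefFlatDecL`. -/
def localSummandFlatDecL (v : WordVersion) (S₁ S₂ : PlateSystem) (P : Finset (EuclideanSpace ℝ (Fin 3)))
    (δ : EuclideanSpace ℝ (Fin 3) → ℕ) (z : EuclideanSpace ℝ (Fin 3)) : ℝ :=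
  ∑ b ∈ P.filter (fun b => dist z b ≤ 1 ∧ 0 < endMultFlat P v S₁ S₂ b), (endMultFlat P v S₁ S₂ b : ℝ) / pooledDefFlatDecL P δ b

/-- **The JOINT row of a lens type, functional of record** (decorated degrees `looseAt₃`, no filler credit, pools `≥ 1`). -/
def ResidueType₃.rowJointL (τ : ResidueType₃) (L₀ : EuclideanSpace ℝ (Fin 3) ≃ₗᵢ[ℝ] EuclideanSpace ℝ (Fin 3)) : ℝ :=
  localSummandFlatDecL WordVersion.v2 (basalSystem L₀)
    (basalSystem (((ℝ ∙ EuclideanSpace.single (2 : Fin 3) (1 : ℝ)).reflection).trans L₀)) τ.realise₃ τ.looseAt₃ 0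

/-- **THE TAIL RESIDUE CERTIFICATE, LENS form, at the line `s`** (the finite fact of record after (cxi)): every well-formed realisable lens
type has `rowJointL ≤ s` at every standard placement.  Instance of record `s = 2√6`. -/
def TailResidueCertL (s : ℝ) : Prop :=
  ∀ τ : ResidueType₃, τ.WellFormed₃ → τ.Realisable₃ →
    ∀ L₀ : EuclideanSpace ℝ (Fin 3) ≃ₗᵢ[ℝ] EuclideanSpace ℝ (Fin 3), StdFrame L₀ → τ.rowJointL L₀ ≤ s

open scoped Classical in
/-- **TYPE SOUNDNESS, LENS form (THE T4 TARGET of record after (cxi))**: at every payer window of a `1`-separated configuration that is NOT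
on-site for 𝒰_cx, either a deletion of inessential balls lands on-site, or the JOINT summand of the frame `L` is bounded by `rowJointL` of some
well-formed realisable lens type at some standard placement. -/
def TailTypeSoundnessL : Prop :=
  ∀ L : EuclideanSpace ℝ (Fin 3) ≃ₗᵢ[ℝ] EuclideanSpace ℝ (Fin 3),
  ∀ X : Finset (EuclideanSpace ℝ (Fin 3)), (∀ p ∈ X, ∀ q ∈ X, p ≠ q → 1 ≤ dist p q) →
  ∀ z ∈ X, (X.filter fun q => dist z q = 1).card ≤ 11 → ¬ OnSiteAt coaxialModuleUniverse X z →
    HasDeletionOnSite X z ∨ ∃ τ : ResidueType₃, τ.WellFormed₃ ∧ τ.Realisable₃ ∧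
      ∃ L₀ : EuclideanSpace ℝ (Fin 3) ≃ₗᵢ[ℝ] EuclideanSpace ℝ (Fin 3), StdFrame L₀ ∧
        localSummandA WordVersion.v2 (basalSystem L)
          (basalSystem (((ℝ ∙ EuclideanSpace.single (2 : Fin 3) (1 : ℝ)).reflection).trans L)) X z ≤ τ.rowJointL L₀

attribute [deprecated ResidueType₃.rowJointL (since := "2026-08-29")] ResidueType₃.rowJoint₃
attribute [deprecated TailResidueCertL (since := "2026-08-29")] TailResidueCert₃
attribute [deprecated TailTypeSoundnessL (since := "2026-08-29")] TailTypeSoundness₃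

end TailResidue

end Summit.Ventures.Crystal3D.Theorems

end
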